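import Literature.Geometry.Symplectic.AdaptedFramePerutzForm
import HarnessLib

/-!
# Block form of Perutz's matrix after rotating the normal frame

Topic `Geometry/Symplectic`; namespace `Literature.Geometry.Symplectic`.  No `sorry`, no named
fact.  Given an adapted frame `(A, c, η)` of a gradient `G` (`AdaptedFramePerutzForm.lean`) and
an orthonormal frame `f₀, f₁, f₂` of `ℝ³` with `f₀ × f₁ = f₂`, the rotated frame
`A' = A ∘ R̄_f` (`rotateFrame`) with the rotated triple `η'_m = Σ_k (f_m)_k η_k` (`rotateTriple`)
is again an adapted frame of `G` (`hvec_rotate`, `isWedgeOrthonormalTriple_rotate`,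
`hexp_rotate`, `rotateFrame_stdVec_zero`), and its Perutz matrix is the conjugate
`T'_{ma} = ⟨f_m, T f_a⟩` (`perutzMatrix_rotate`).  Hence if `f₂` is an eigenvector of (a
multiple `μT` of) the symmetric matrix `T` with `μT` positive definite on `f₂^⊥`, the new matrix
is in BLOCK form `S⁺ ⊕ S⁻`: last row and column `(0, 0, λ)`, upper block positive definite
(`perutzMatrix_rotate_block`, `perutzMatrix_rotate_pos`), and the gradient reads
`G(A'W)(A'U, A'V) = c Σ_k (T' W_N)_k β_k(U, V)` (`gradient_rotate`).  This is step 1 of the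
proof of Perutz 2006, Lemma 3.1: "`S(t) = S⁺(t) ⊕ S⁻(t)`, where `S⁺(t)` is `2 × 2` and
positive-definite, and `S⁻(t) < 0`".

## References

* T. Perutz, *Zero-sets of near-symplectic forms*, J. Symplectic Geom. 4 (2006), §3 (proof of
  Lemma 3.1, step 1). [Perutz2006]
-/

noncomputable section

open Set Function Module Matrix Literature.Geometry.Kaehler Literature.Topology.FourManifolds
  Literature.Analysis.Matrix
open scoped Matrix

namespace Literature.Geometry.Symplectic

variable {G : EuclideanSpace ℝ (Fin 4) →L[ℝ] ((EuclideanSpace ℝ (Fin 4)) [⋀^Fin 2]→L[ℝ] ℝ)}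
  {A : EuclideanSpace ℝ (Fin 4) ≃L[ℝ] EuclideanSpace ℝ (Fin 4)} {c s : ℝ}
  {η : Fin 3 → (EuclideanSpace ℝ (Fin 4)) [⋀^Fin 2]→L[ℝ] ℝ} {f : Fin 3 → Fin 3 → ℝ}

/-! ### The rotated frame and triple -/

/-- **The rotated frame** `A' = A ∘ R̄_f`. [cite: Perutz2006, §3 (proof of Lemma 3.1, step 1)] -/
def rotateFrame (A : EuclideanSpace ℝ (Fin 4) ≃L[ℝ] EuclideanSpace ℝ (Fin 4))
    (f : Fin 3 → Fin 3 → ℝ) (horth : ∀ i j, f i ⬝ᵥ f j = if i = j then 1 else 0) :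
    EuclideanSpace ℝ (Fin 4) ≃L[ℝ] EuclideanSpace ℝ (Fin 4) :=
  (rotateNormalEquiv f horth).trans A

/-- **The rotated triple** `η'_m = Σ_k (f_m)_k η_k`. [cite: Perutz2006, §3 (proof of Lemma 3.1, step 1)] -/
def rotateTriple (f : Fin 3 → Fin 3 → ℝ) (η : Fin 3 → (EuclideanSpace ℝ (Fin 4)) [⋀^Fin 2]→L[ℝ] ℝ) :
    Fin 3 → (EuclideanSpace ℝ (Fin 4)) [⋀^Fin 2]→L[ℝ] ℝ :=
  fun m ↦ ∑ k, f m k • η k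

/-- The rotated frame, unfolded. [folklore] -/
@[simp] theorem rotateFrame_apply (horth : ∀ i j, f i ⬝ᵥ f j = if i = j then 1 else 0)
    (u : EuclideanSpace ℝ (Fin 4)) : rotateFrame A f horth u = A (rotateNormal f u) := rfl

/-- The rotated triple, unfolded. [folklore] -/
theorem rotateTriple_apply (m : Fin 3) : rotateTriple f η m = ∑ k, f m k • η k := rfl

/-- The rotated frame fixes the axis vector. [folklore] -/
theorem rotateFrame_stdVec_zero (horth : ∀ i j, f i ⬝ᵥ f j = if i = j then 1 else 0)
    (hA0 : A (stdVec 0) = stdVec 0) : rotateFrame A f horth (stdVec 0) = stdVec 0 := by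
  rw [rotateFrame_apply, rotateNormal_stdVec_zero, hA0]

/-- **The rotated triple is adapted to the rotated frame.** [cite: Perutz2006, §3 (proof of Lemma 3.1, step 1)] -/
theorem hvec_rotate (horth : ∀ i j, f i ⬝ᵥ f j = if i = j then 1 else 0)
    (hcross : f 0 ⨯₃ f 1 = f 2) (hvec : ∀ k u v, η k ![A u, A v] = c * hondaBetaVec u v k)
    (m : Fin 3) (u v : EuclideanSpace ℝ (Fin 4)) :
    rotateTriple f η m ![rotateFrame A f horth u, rotateFrame A f horth v] =
      c * hondaBetaVec u v m :=
  rotate_frame_relation horth hcross hvec m u v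

/-- **The rotated triple is wedge-orthonormal.** [cite: Perutz2006, Lemma 2.1 (b)] -/
theorem isWedgeOrthonormalTriple_rotate (horth : ∀ i j, f i ⬝ᵥ f j = if i = j then 1 else 0)
    (hW : IsWedgeOrthonormalTriple (η 0) (η 1) (η 2) s) :
    IsWedgeOrthonormalTriple (rotateTriple f η 0) (rotateTriple f η 1) (rotateTriple f η 2) s :=
  hW.rotate_triple horth

/-- **Expansion of the gradient against the rotated triple.** [folklore] -/
theorem hexp_rotate (horth : ∀ i j, f i ⬝ᵥ f j = if i = j then 1 else 0)
    (hW : IsWedgeOrthonormalTriple (η 0) (η 1) (η 2) s)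
    (hexp : ∀ W, G W = ∑ k, (pfaffianPair (G W) (η k) / (2 * s)) • η k)
    (W : EuclideanSpace ℝ (Fin 4)) :
    G W = ∑ m, (pfaffianPair (G W) (rotateTriple f η m) / (2 * s)) • rotateTriple f η m := by
  have h : G W = ∑ m, (∑ k, f m k * (pfaffianPair (G W) (η k) / (2 * s))) • rotateTriple f η m := by
    conv_lhs => rw [hexp W]
    exact sum_smul_eq_sum_rotate_triple horth _
  exact (hW.rotate_triple horth).eq_sum_pfaffianPair_smul (η := rotateTriple f η) h

/-! ### The rotated Perutz matrix -/

/-- The normal part of a basis vector `e_{a+1}` is `Pi.single a 1`. [folklore] -/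
theorem normalPart_stdVec_succ (a : Fin 3) :
    normalPart (stdVec a.succ : EuclideanSpace ℝ (Fin 4)) = Pi.single a 1 := by
  funext j
  fin_cases a <;> fin_cases j <;> simp [stdVec]

/-- The rotation sends `e_{a+1}` to the lift of `f_a`: normal part `f_a`. [folklore] -/
theorem normalPart_rotateNormal_stdVec_succ (a : Fin 3) :
    normalPart (rotateNormal f (stdVec a.succ)) = f a := by
  rw [normalPart_rotateNormal]
  have h : ∀ m : Fin 3, (stdVec a.succ : EuclideanSpace ℝ (Fin 4)) m.succ = if m = a then 1 else 0 :=
    fun m ↦ by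
      have := congrFun (normalPart_stdVec_succ a) m
      rw [normalPart_apply] at this
      rw [this, Pi.single_apply]
  simp only [h, ite_smul, one_smul, zero_smul, Finset.sum_ite_eq', Finset.mem_univ, if_true]

/-- **The Perutz matrix of the rotated frame is the conjugate `⟨f_m, T f_a⟩`.**
[cite: Perutz2006, §3 (proof of Lemma 3.1, step 1)] -/
theorem perutzMatrix_rotate (horth : ∀ i j, f i ⬝ᵥ f j = if i = j then 1 else 0)
    (hA0 : A (stdVec 0) = stdVec 0) (hG0 : G (stdVec 0) = 0) (m a : Fin 3) :
    perutzMatrix G (rotateFrame A f horth) (rotateTriple f η) s m a =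
      f m ⬝ᵥ perutzMatrix G A η s *ᵥ f a := by
  rw [perutzMatrix_apply, perutzCoeff_apply, rotateFrame_apply, rotateTriple_apply,
    pfaffianPair_rotate_triple, dotProduct, Finset.sum_div]
  refine Finset.sum_congr rfl fun k _ ↦ ?_
  rw [mul_div_assoc, ← perutzCoeff_apply, perutzCoeff_eq_mulVec hA0 hG0,
    normalPart_rotateNormal_stdVec_succ]

/-- The rotated matrix is symmetric if the original is. [folklore] -/
theorem perutzMatrix_rotate_isSymm (horth : ∀ i j, f i ⬝ᵥ f j = if i = j then 1 else 0)
    (hA0 : A (stdVec 0) = stdVec 0) (hG0 : G (stdVec 0) = 0) (hT : (perutzMatrix G A η s).IsSymm) :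
    (perutzMatrix G (rotateFrame A f horth) (rotateTriple f η) s).IsSymm := by
  refine Matrix.IsSymm.ext fun m a ↦ ?_
  rw [perutzMatrix_rotate horth hA0 hG0, perutzMatrix_rotate horth hA0 hG0,
    dotProduct_mulVec_comm_of_isSymm hT]

/-- **Block form**: if `f₂` is an eigenvector of `μT` (eigenvalue `λ`) then the last column of the
rotated matrix is `μ⁻¹ λ (0, 0, 1)`: `μ T'_{m2} = λ δ_{m2}`.
[cite: Perutz2006, §3 (proof of Lemma 3.1, step 1)] -/
theorem perutzMatrix_rotate_col (horth : ∀ i j, f i ⬝ᵥ f j = if i = j then 1 else 0)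
    (hA0 : A (stdVec 0) = stdVec 0) (hG0 : G (stdVec 0) = 0) {μ lam : ℝ}
    (hf2 : (μ • perutzMatrix G A η s) *ᵥ f 2 = lam • f 2) (m : Fin 3) :
    μ * perutzMatrix G (rotateFrame A f horth) (rotateTriple f η) s m 2 =
      if m = 2 then lam else 0 := by
  rw [perutzMatrix_rotate horth hA0 hG0, ← smul_eq_mul, ← dotProduct_smul, ← smul_mulVec,
    hf2, dotProduct_smul, smul_eq_mul, horth]
  split_ifs <;> simp

/-- **Block form, rows**: for symmetric `T`, also `μ T'_{2m} = λ δ_{m2}`. [folklore] -/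
theorem perutzMatrix_rotate_row (horth : ∀ i j, f i ⬝ᵥ f j = if i = j then 1 else 0)
    (hA0 : A (stdVec 0) = stdVec 0) (hG0 : G (stdVec 0) = 0) (hT : (perutzMatrix G A η s).IsSymm)
    {μ lam : ℝ} (hf2 : (μ • perutzMatrix G A η s) *ᵥ f 2 = lam • f 2) (m : Fin 3) :
    μ * perutzMatrix G (rotateFrame A f horth) (rotateTriple f η) s 2 m =
      if m = 2 then lam else 0 := by
  rw [(perutzMatrix_rotate_isSymm horth hA0 hG0 hT).apply m 2]
  exact perutzMatrix_rotate_col horth hA0 hG0 hf2 m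

/-- A matrix applied to a finite combination. [folklore] -/
theorem mulVec_sum_smul {ι : Type*} (t : Finset ι) (T : Matrix (Fin 3) (Fin 3) ℝ) (a : ι → ℝ)
    (g : ι → Fin 3 → ℝ) : T *ᵥ (∑ i ∈ t, a i • g i) = ∑ i ∈ t, a i • T *ᵥ g i := by
  rw [← Matrix.toLin'_apply, map_sum]
  exact Finset.sum_congr rfl fun i _ ↦ by rw [map_smul, Matrix.toLin'_apply]

/-- The quadratic form of the rotated matrix: `⟨v, T' v⟩ = ⟨x, T x⟩` for `x = Σ_m v_m f_m`.
[folklore] -/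
theorem quadratic_perutzMatrix_rotate (horth : ∀ i j, f i ⬝ᵥ f j = if i = j then 1 else 0)
    (hA0 : A (stdVec 0) = stdVec 0) (hG0 : G (stdVec 0) = 0) (v : Fin 3 → ℝ) :
    v ⬝ᵥ perutzMatrix G (rotateFrame A f horth) (rotateTriple f η) s *ᵥ v =
      (∑ m, v m • f m) ⬝ᵥ perutzMatrix G A η s *ᵥ (∑ a, v a • f a) := by
  set T' := perutzMatrix G (rotateFrame A f horth) (rotateTriple f η) s with hT'
  rw [mulVec_sum_smul, sum_dotProduct]
  simp only [smul_dotProduct, dotProduct_sum, dotProduct_smul, smul_eq_mul]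
  have hL : v ⬝ᵥ T' *ᵥ v = ∑ m, v m * ∑ a, T' m a * v a := rfl
  rw [hL]
  refine Finset.sum_congr rfl fun m _ ↦ ?_
  rw [Finset.mul_sum]
  refine Finset.sum_congr rfl fun a _ ↦ ?_
  rw [hT', perutzMatrix_rotate horth hA0 hG0]
  ring

/-- **Positivity of the upper block**: if `T` is positive definite on `f₂^⊥` then the rotated
matrix is positive definite on `{v | v₂ = 0}`. [cite: Perutz2006, §3 (proof of Lemma 3.1, step 1)] -/
theorem perutzMatrix_rotate_pos (horth : ∀ i j, f i ⬝ᵥ f j = if i = j then 1 else 0)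
    (hA0 : A (stdVec 0) = stdVec 0) (hG0 : G (stdVec 0) = 0) {μ : ℝ}
    (hpos : ∀ x, x ⬝ᵥ f 2 = 0 → x ≠ 0 → 0 < x ⬝ᵥ (μ • perutzMatrix G A η s) *ᵥ x)
    {v : Fin 3 → ℝ} (hv2 : v 2 = 0) (hv : v ≠ 0) :
    0 < v ⬝ᵥ (μ • perutzMatrix G (rotateFrame A f horth) (rotateTriple f η) s) *ᵥ v := by
  set x : Fin 3 → ℝ := ∑ m, v m • f m with hx
  have hxf : ∀ j, x ⬝ᵥ f j = v j := fun j ↦ by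
    rw [hx, sum_dotProduct]
    simp only [smul_dotProduct, smul_eq_mul, horth, mul_ite, mul_one, mul_zero,
      Finset.sum_ite_eq', Finset.mem_univ, if_true]
  have hx2 : x ⬝ᵥ f 2 = 0 := by rw [hxf, hv2]
  have hx0 : x ≠ 0 := by
    intro h0
    apply hv
    funext j
    rw [← hxf j, h0, zero_dotProduct]
    rfl
  have h := hpos x hx2 hx0
  rw [smul_mulVec, dotProduct_smul, smul_eq_mul] at h ⊢
  rwa [quadratic_perutzMatrix_rotate horth hA0 hG0]

/-! ### The gradient in the rotated frame -/

/-- **The gradient in the rotated frame**: `G(A'W)(A'U, A'V) = c Σ_k (T' W_N)_k β_k(U, V)`.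
[cite: Perutz2006, §3 (proof of Lemma 3.1, step 1)] -/
theorem gradient_rotate (horth : ∀ i j, f i ⬝ᵥ f j = if i = j then 1 else 0)
    (hcross : f 0 ⨯₃ f 1 = f 2) (hvec : ∀ k u v, η k ![A u, A v] = c * hondaBetaVec u v k)
    (hW : IsWedgeOrthonormalTriple (η 0) (η 1) (η 2) s)
    (hexp : ∀ W, G W = ∑ k, (pfaffianPair (G W) (η k) / (2 * s)) • η k)
    (hA0 : A (stdVec 0) = stdVec 0) (hG0 : G (stdVec 0) = 0) (W U V : EuclideanSpace ℝ (Fin 4)) :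
    G (rotateFrame A f horth W) ![rotateFrame A f horth U, rotateFrame A f horth V] =
      c * ∑ k, (perutzMatrix G (rotateFrame A f horth) (rotateTriple f η) s *ᵥ normalPart W) k *
        hondaBetaVec U V k := by
  rw [gradient_frame_sum (hvec_rotate horth hcross hvec) (hexp_rotate horth hW hexp) W U V]
  congr 1
  exact Finset.sum_congr rfl fun k _ ↦ by
    rw [perutzCoeff_eq_mulVec (rotateFrame_stdVec_zero horth hA0) hG0]

end Literature.Geometry.Symplectic

end
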